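import Summits.AtomisticToContinuum.Crystallization.Theorems.FrustratedLawDichotomyStrainedPatchSoftSplitB

/-!
# Strained patch — «SoftSplit», part main (C): §5 the INSTRUMENTABLE form of (S) (amplitude ball over a finite mode table)
(lens-5 g85 NODE «SoftSplit» v4 b69f86162b2d6362, 688 l, dedup edit = probes/DedupT26-85.lean 56abb292…; 3-way cut at §2‖§3 and §4‖§5 under the 400-line cap by
hand-2 g39 for landing: A = §0–§2, B = §3–§4, main = §5; bodies byte-verbatim, header/opens repeated; full module docstring in part A.) -/

noncomputable section

open scoped BigOperators Classical
open Literature.Analysis.ValidatedNumerics.Numerics (SC)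
open Summit.AtomisticToContinuum.Crystallization.Theorems.FrustratedLawDichotomyAperiodicGapRecordJunctionHomFloorF6pT26 (level_ok_fallback_A35000_T26)
open Summit.AtomisticToContinuum.Crystallization.Theorems.ChargedEnergyGapNegative (eStar E3)
open Summit.AtomisticToContinuum.Crystallization.Theorems.FrustratedLawDichotomyRangeCut
open Summit.AtomisticToContinuum.Crystallization.Theorems.FrustratedLawDichotomySchurCut
open Summit.AtomisticToContinuum.Crystallization.Theorems.FrustratedLawDichotomyMotifLemmas (GoodAtScale)
open Summit.AtomisticToContinuum.Crystallization.Theorems.FrustratedLawDichotomyAveragingCut (ballAvg)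
open Summit.AtomisticToContinuum.Crystallization.Theorems.FrustratedLawDichotomyExemptLocOpt (LocOptFails)
open Summit.AtomisticToContinuum.Crystallization.Theorems.FrustratedLawDichotomyExemptSplit (SchurElasticPricingX)
open Summit.AtomisticToContinuum.Crystallization.Theorems.FrustratedLawDichotomyExemptAbsorptionRecord
open Summit.AtomisticToContinuum.Crystallization.Theorems.FrustratedLawDichotomyCollarCensus
open Summit.AtomisticToContinuum.Crystallization.Theorems.FrustratedLawDichotomyCollarCensusKappa
open Summit.AtomisticToContinuum.Crystallization.Theorems.FrustratedLawDichotomyStrainedPatchHomSplit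
open Summit.AtomisticToContinuum.Crystallization.Theorems.FrustratedLawDichotomyStrainedPatchCleanCollar (CleanBall TailPenalty AnnularDefectFloor
  DefectiveCollarFloor tailOut)
open Summit.AtomisticToContinuum.Crystallization.Theorems.FrustratedLawDichotomyStrainedPatchPhaseCut (MonoPhaseBall AnnularPhaseFloor PolyTextureFloor
  monoPhaseBall_comp_iff FccGoodAtScale)
open Summit.AtomisticToContinuum.Crystallization.Theorems.FrustratedLawDichotomyStrainedPatchCoreTube (NearHomIsoAt CoreOffTubeFloor RimOffTubeFloor nearHomIsoAt_comp_iff)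
open Summit.AtomisticToContinuum.Crystallization.Theorems.FrustratedLawDichotomyStrainedPatchCoreTubeRecord (CoreCoreRelief)
open Summit.AtomisticToContinuum.Crystallization.Theorems.FrustratedLawDichotomyStrainedPatchStrainBands (EdgeFarFloor coreOff_iff_edge_and_soft
  softFarFloor_eighth)
open Summit.AtomisticToContinuum.Crystallization.Theorems.FrustratedLawDichotomyStrainedPatchHomIsometry (admissible_comp_iff goodAtScale_comp_iff
  dist_comp injective_comp_iff)
open Summit.AtomisticToContinuum.Crystallization.Theorems.FrustratedLawDichotomyStrainedPatchHomTubeIso (cleanBall_comp_iff ballAvg_xRec_comp)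
open Summit.AtomisticToContinuum.Crystallization.Theorems.FrustratedLawDichotomyStrainedPatchChartFamilies (ChartBy FamilyLE familyLE_refl
  ChartBy.mono_t ChartBy.mono_family)
open Summit.AtomisticToContinuum.Crystallization.Theorems.FrustratedLawDichotomyStrainedPatchHostCells (TubeFloor FamilyCover FamP)
open Summit.AtomisticToContinuum.Crystallization.Theorems.FrustratedLawDichotomyStrainedPatchQuantSlaving (ChartFam SlackTab)
open Summit.AtomisticToContinuum.Crystallization.Theorems.FrustratedLawDichotomyStrainedPatchGradedTube
open Summit.AtomisticToContinuum.Crystallization.Theorems.FrustratedLawDichotomyStrainedPatchCoverBridge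
open Summit.AtomisticToContinuum.Crystallization.Theorems.FrustratedLawDichotomyStrainedPatchPairTube
open Summit.AtomisticToContinuum.Crystallization.Theorems.FrustratedLawDichotomyStrainedPatchHomCertTree (CertTree treeOK)
open Summit.AtomisticToContinuum.Crystallization.Theorems.FrustratedLawDichotomyStrainedPatchHomEntryGram (rootC rootW)
open Summit.AtomisticToContinuum.Crystallization.Theorems.FrustratedLawDichotomyStrainedPatchHomEntryGramHcp (rootCH rootWH)
open Summit.AtomisticToContinuum.Crystallization.Theorems.FrustratedLawDichotomyStrainedPatchHomEntryLeafHT (entryLeafOK6RBKP4 semOKH)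
open Summit.AtomisticToContinuum.Crystallization.Theorems.FrustratedLawDichotomyAperiodicGapRecordJunctionHomFloorF6p
open Summit.AtomisticToContinuum.Crystallization.Theorems.FrustratedLawDichotomyAperiodicGapRecordJunctionHomFloorGraded

namespace Summit.AtomisticToContinuum.Crystallization.Theorems.FrustratedLawDichotomyStrainedPatchSoftSplit

/-! ## §5. The INSTRUMENTABLE form of (S): amplitude ball over a finite mode table ⇒ (S) = (per-mode tables, a finite computation) × (ONE amplitude bound) -/

section SpanBall

variable {k : ℕ}

/-- A MODE TABLE: `k` host-indexed displacement fields (intended: the certified sub-`λ₀` eigenmodes of the host's Dirichlet block Hessian, STAB-85). -/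
abbrev ModeTab (k : ℕ) : Type := (M₀ : ℕ) → (Fin M₀ → E3) → Fin M₀ → Fin k → (Fin M₀ → E3)

/-- (piece) [route statement · this cell; NOT a literature fact] **`spanBall Φ Amax`** — the soft fields that are linear combinations of the `k` table modes
with every amplitude `|aᵢ| ≤ Amax`. -/
def spanBall (Φ : ModeTab k) (Amax : ℝ) : ModeFam := fun M₀ z₀ c₀ v =>
  ∃ a : Fin k → ℝ, (∀ i, |a i| ≤ Amax) ∧ ∀ x, v x = ∑ i, a i • Φ M₀ z₀ c₀ i x

/-- The zero field belongs to every amplitude ball (all amplitudes `0`). [formal bookkeeping] (lane docstring, hand-2 g39) -/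
theorem zeroMem_spanBall (Φ : ModeTab k) {Amax : ℝ} (hA : 0 ≤ Amax) : ZeroMem (spanBall Φ Amax) :=
  fun M₀ z₀ c₀ => ⟨fun _ => 0, fun _ => by simpa using hA, fun x => by simp⟩

/-- Triangle inequality for amplitude-weighted mode sums. [formal bookkeeping] -/
theorem norm_sum_smul_sub_le (a : Fin k → ℝ) (f g : Fin k → E3) {Amax s : ℝ} (hA : 0 ≤ Amax) (ha : ∀ i, |a i| ≤ Amax)
    (hs : ∑ i, ‖f i - g i‖ ≤ s) : ‖(∑ i, a i • f i) - ∑ i, a i • g i‖ ≤ Amax * s := by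
  have h1 : (∑ i, a i • f i) - ∑ i, a i • g i = ∑ i, a i • (f i - g i) := by
    rw [← Finset.sum_sub_distrib]
    exact Finset.sum_congr rfl fun i _ => (smul_sub (a i) (f i) (g i)).symm
  rw [h1]
  calc ‖∑ i, a i • (f i - g i)‖ ≤ ∑ i, ‖a i • (f i - g i)‖ := norm_sum_le _ _
    _ = ∑ i, |a i| * ‖f i - g i‖ := by simp [norm_smul, Real.norm_eq_abs]
    _ ≤ ∑ i, Amax * ‖f i - g i‖ := Finset.sum_le_sum fun i _ => mul_le_mul_of_nonneg_right (ha i) (norm_nonneg _)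
    _ = Amax * ∑ i, ‖f i - g i‖ := (Finset.mul_sum _ _ _).symm
    _ ≤ Amax * s := mul_le_mul_of_nonneg_left hs hA

/-- ★★ **(S) FOR AN AMPLITUDE BALL = PER-MODE TABLES × AMPLITUDE.**  If the per-mode site / slack / pair oscillation SUMS of the table are bounded by `t₁`, `T₁`, `B₁`
(a FINITE computation on the `k` modes per host — kit-certifiable by interval arithmetic), then `spanBall Φ Amax` satisfies (S) with the tables scaled by `Amax`.
[formal bookkeeping; this is the «per unit amplitude (S) is a finite computation» clause of the node] -/
theorem softEnvelope_spanBall {Φ : ModeTab k} {Amax t₁ : ℝ} {T₁ : SlackTab} {B₁ : PairTab} (hA : 0 ≤ Amax)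
    (ht : ∀ (M₀ : ℕ) (z₀ : Fin M₀ → E3) (c₀ a : Fin M₀), ∑ i, ‖Φ M₀ z₀ c₀ i a - Φ M₀ z₀ c₀ i c₀‖ ≤ t₁)
    (hT : ∀ (M₀ : ℕ) (z₀ : Fin M₀ → E3) (c₀ a : Fin M₀), ∑ i, ‖Φ M₀ z₀ c₀ i a - Φ M₀ z₀ c₀ i c₀‖ ≤ T₁ M₀ z₀ c₀ a)
    (hB : ∀ (M₀ : ℕ) (z₀ : Fin M₀ → E3) (c₀ a b : Fin M₀), ∑ i, ‖Φ M₀ z₀ c₀ i a - Φ M₀ z₀ c₀ i b‖ ≤ B₁ M₀ z₀ c₀ a b) :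
    SoftEnvelope (spanBall Φ Amax) (Amax * t₁) (fun M₀ z₀ c₀ a => Amax * T₁ M₀ z₀ c₀ a) (fun M₀ z₀ c₀ a b => Amax * B₁ M₀ z₀ c₀ a b) := by
  intro M₀ z₀ c₀ v hv
  obtain ⟨a, ha, hv⟩ := hv
  refine ⟨fun x => ?_, fun x => ?_, fun x y => ?_⟩
  · rw [hv x, hv c₀]; exact norm_sum_smul_sub_le a _ _ hA ha (ht M₀ z₀ c₀ x)
  · rw [hv x, hv c₀]; exact norm_sum_smul_sub_le a _ _ hA ha (hT M₀ z₀ c₀ x)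
  · rw [hv x, hv y]; exact norm_sum_smul_sub_le a _ _ hA ha (hB M₀ z₀ c₀ x y)

/-- ★★ **(S) SPLITS AS (S_amp) ∧ (S_tab)**: an AMPLITUDE BOUND `ModesLE 𝓥 (spanBall Φ Amax)` («every admissible soft field at the host is a table combination
with amplitudes `≤ Amax`» — the anharmonic / reduced-equation content, the ONE number SOFT-85 measures per host class) and the per-mode TABLES (finite) give (S)
for `𝓥`. [formal bookkeeping: `softEnvelope_spanBall` + `SoftEnvelope.anti_modes`] -/
theorem softEnvelope_of_amplitude_of_tables {𝓥 : ModeFam} {Φ : ModeTab k} {Amax t₁ : ℝ} {T₁ : SlackTab} {B₁ : PairTab} (hA : 0 ≤ Amax)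
    (hamp : ModesLE 𝓥 (spanBall Φ Amax))
    (ht : ∀ (M₀ : ℕ) (z₀ : Fin M₀ → E3) (c₀ a : Fin M₀), ∑ i, ‖Φ M₀ z₀ c₀ i a - Φ M₀ z₀ c₀ i c₀‖ ≤ t₁)
    (hT : ∀ (M₀ : ℕ) (z₀ : Fin M₀ → E3) (c₀ a : Fin M₀), ∑ i, ‖Φ M₀ z₀ c₀ i a - Φ M₀ z₀ c₀ i c₀‖ ≤ T₁ M₀ z₀ c₀ a)
    (hB : ∀ (M₀ : ℕ) (z₀ : Fin M₀ → E3) (c₀ a b : Fin M₀), ∑ i, ‖Φ M₀ z₀ c₀ i a - Φ M₀ z₀ c₀ i b‖ ≤ B₁ M₀ z₀ c₀ a b) :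
    SoftEnvelope 𝓥 (Amax * t₁) (fun M₀ z₀ c₀ a => Amax * T₁ M₀ z₀ c₀ a) (fun M₀ z₀ c₀ a b => Amax * B₁ M₀ z₀ c₀ a b) :=
  (softEnvelope_spanBall hA ht hT hB).anti_modes hamp

end SpanBall

end Summit.AtomisticToContinuum.Crystallization.Theorems.FrustratedLawDichotomyStrainedPatchSoftSplit

end
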